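import Mathlib
import Summits.Ventures.PercRepro.TriangleCapRegularCellSix

/-!
# PercRepro — THE REGULAR CELL `t = 7 D` ON `8 + (s − t)` VERTICES, EXACTLY: `{bottom, bottom + 6, bottom + 10, bottom + 11, bottom + 12} ∪ [bottom + 14, bottom + 21 D]`
(p3, gen 55; part 309)

At `ℓ = 7` the row excess `Σ_{rows} k (7 − k)` is `0`, `12` or at least `20` (parts 290–291) and at most `42 D`; and it
is NEVER `26` (THE THIRD GAP, `no_thirteen_seven`): with `n_j` rows of size `j`, `Σ k (7 − k) = 6 (n₁ + n₆) + 10 (n₂ + n₅)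
+ 12 (n₃ + n₄) = 26` forces `n₃ = n₄ = 0`, `n₁ + n₆ = 1`, `n₂ + n₅ = 2`, and then `Σ k ≡ n₁ − n₆ + 2 (n₂ − n₅) ∈
{±1, ±1 ± 4} ≢ 0 (mod 7)`, against `Σ k = 7 D`.  Conversely the values `6, 10, 11, 12` are the rows `(6,1)`, `(5,2)`,
`(5,1,1)`, `(4,3)` and every `14 ≤ m ≤ 21 D` is realised by blocks of seven edges (`(4,2,1)` … `(1^7)`, the values
`14 … 21`) and of fourteen edges (`22 … 42`), with `m = 21 a + e`, `a = min(⌊(m − 14)/21⌋, D − 2)`, `e ∈ [14, 42]`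
(`rows_of_excess_seven`).  THEOREM (`regular_cell_seven`, `7 ≤ D`, `t = 7 D`, `2 t ≤ s`): `j` is the band value of a
triangle-free graph on `8 + (s − t)` vertices with `s` edges, a vertex of degree `s − t` and every off-degree `≤ D`
IFF `j − bottomReg 7 D ∈ {0, 6, 10, 11, 12} ∪ [14, 21 D]` — the excess set at `ℓ = 7` misses exactly
`{1, …, 5, 7, 8, 9, 13}`; the third gap `{13}` is new (the first two are parts 290–291).  Axioms: standard.
-/

namespace PercRepro

namespace TriangleCap

namespace C047

open Finset

/-- The entries of a list in `[1, 7]` give a sequence in `[1, 7]` below the length. -/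
theorem getD_bounds_seven (L : List ℕ) (hL : ∀ x ∈ L, 1 ≤ x ∧ x ≤ 7) (i : ℕ) (hi : i < L.length) :
    1 ≤ L.getD i 0 ∧ L.getD i 0 ≤ 7 := by
  rw [List.getD_eq_getElem L 0 hi]
  exact hL _ (List.getElem_mem hi)

/-- A sum of a function of the row sizes is the sum over the sizes `j ≤ 7` of `n_j · f(j)`, `n_j` the number of rows
of size `j`. -/
theorem sum_rows_eq_sum_counts (k : ℕ → ℕ) (N : ℕ) (hk : ∀ i, i < N → k i ≤ 7) (f : ℕ → ℕ) :
    ∑ i ∈ range N, f (k i) = ∑ j ∈ range 8, ((range N).filter (fun i => k i = j)).card * f j := by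
  rw [← sum_fiberwise_of_maps_to (s := range N) (t := range 8) (g := k) (fun i hi => by
    rw [mem_range] at hi ⊢
    have := hk i hi
    omega)]
  apply sum_congr rfl
  intro j _
  rw [card_eq_sum_ones, sum_mul, one_mul]
  apply sum_congr rfl
  intro i hi
  rw [mem_filter] at hi
  rw [hi.2]

/-- **THE THIRD GAP AT `ℓ = 7`:** row sizes `1 ≤ k ≤ 7` with `Σ k = 7 D` never have `Σ k (7 − k) = 26`. -/
theorem no_thirteen_seven (D : ℕ) (k : ℕ → ℕ) (N : ℕ) (hk : ∀ i, i < N → 1 ≤ k i ∧ k i ≤ 7)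
    (hsum : ∑ i ∈ range N, k i = 7 * D) : ∑ i ∈ range N, k i * (7 - k i) ≠ 26 := by
  intro h26
  have h1 := sum_rows_eq_sum_counts k N (fun i hi => (hk i hi).2) (fun j => j)
  have h2 := sum_rows_eq_sum_counts k N (fun i hi => (hk i hi).2) (fun j => j * (7 - j))
  simp only [sum_range_succ, sum_range_zero] at h1 h2
  norm_num at h1 h2
  rw [h1] at hsum
  rw [h2] at h26
  set n1 := ((range N).filter (fun i => k i = 1)).card
  set n2 := ((range N).filter (fun i => k i = 2)).card
  set n3 := ((range N).filter (fun i => k i = 3)).card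
  set n4 := ((range N).filter (fun i => k i = 4)).card
  set n5 := ((range N).filter (fun i => k i = 5)).card
  set n6 := ((range N).filter (fun i => k i = 6)).card
  set n7 := ((range N).filter (fun i => k i = 7)).card
  -- mod 3: `n₂ + n₅ ≡ 2`, and `10 (n₂ + n₅) ≤ 26`
  have hy : n2 + n5 = 2 := by
    have hm3 : (n1 * 6 + n2 * 10 + n3 * 12 + n4 * 12 + n5 * 10 + n6 * 6) % 3 = 26 % 3 := by omega
    omega
  have hx : n1 + 2 * n3 + 2 * n4 + n6 = 1 := by omega
  have hn3 : n3 = 0 := by omega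
  have hn4 : n4 = 0 := by omega
  have hn6 : n6 = 1 - n1 := by omega
  have hn5 : n5 = 2 - n2 := by omega
  have hb1 : n1 ≤ 1 := by omega
  have hb2 : n2 ≤ 2 := by omega
  rw [hn3, hn4, hn6, hn5] at hsum
  -- `Σ k ≡ 16 − 5 n₁ − 3 n₂ (mod 7)` is never `0`
  interval_cases n1 <;> interval_cases n2 <;> omega

/-- The block of excess `e ∈ {6, 10, 11, 12} ∪ [14, 42]` (rows of seven or fourteen edges): its sizes. -/
def blockSeven (e : ℕ) : List ℕ :=
  if e = 6 then [6, 1] else if e = 10 then [5, 2] else if e = 11 then [5, 1, 1] else if e = 12 then [4, 3]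
  else if e = 14 then [4, 2, 1] else if e = 15 then [3, 3, 1] else if e = 16 then [3, 2, 2]
  else if e = 17 then [3, 2, 1, 1] else if e = 18 then [2, 2, 2, 1] else if e = 19 then [2, 2, 1, 1, 1]
  else if e = 20 then [2, 1, 1, 1, 1, 1] else if e = 21 then [1, 1, 1, 1, 1, 1, 1]
  else if e = 22 then [6, 1, 3, 2, 2] else if e = 23 then [6, 1, 3, 2, 1, 1] else if e = 24 then [5, 2, 4, 2, 1]
  else if e = 25 then [5, 2, 3, 3, 1] else if e = 26 then [5, 2, 3, 2, 2] else if e = 27 then [5, 2, 3, 2, 1, 1]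
  else if e = 28 then [4, 2, 1, 4, 2, 1] else if e = 29 then [4, 2, 1, 3, 3, 1] else if e = 30 then [4, 2, 1, 3, 2, 2]
  else if e = 31 then [4, 2, 1, 3, 2, 1, 1] else if e = 32 then [4, 2, 1, 2, 2, 2, 1]
  else if e = 33 then [4, 2, 1, 2, 2, 1, 1, 1] else if e = 34 then [4, 2, 1, 2, 1, 1, 1, 1, 1]
  else if e = 35 then [4, 2, 1, 1, 1, 1, 1, 1, 1, 1] else if e = 36 then [3, 3, 1, 1, 1, 1, 1, 1, 1, 1]
  else if e = 37 then [3, 2, 2, 1, 1, 1, 1, 1, 1, 1] else if e = 38 then [3, 2, 1, 1, 1, 1, 1, 1, 1, 1, 1]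
  else if e = 39 then [2, 2, 2, 1, 1, 1, 1, 1, 1, 1, 1] else if e = 40 then [2, 2, 1, 1, 1, 1, 1, 1, 1, 1, 1, 1]
  else if e = 41 then [2, 1, 1, 1, 1, 1, 1, 1, 1, 1, 1, 1, 1] else [1, 1, 1, 1, 1, 1, 1, 1, 1, 1, 1, 1, 1, 1]

/-- The facts about a block: entries in `[1, 7]`, sum `7` or `14` (`7` for `e ≤ 21`), excess `Σ k (7 − k) = 2 e`. -/
theorem blockSeven_facts (e : ℕ) (he : e = 6 ∨ e = 10 ∨ e = 11 ∨ e = 12 ∨ (14 ≤ e ∧ e ≤ 42)) :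
    (∀ x ∈ blockSeven e, 1 ≤ x ∧ x ≤ 7) ∧ ((blockSeven e).sum = 7 ∨ (blockSeven e).sum = 14) ∧
      (e ≤ 21 → (blockSeven e).sum = 7) ∧ ((blockSeven e).map (fun k => k * (7 - k))).sum = 2 * e := by
  unfold blockSeven
  rcases he with rfl | rfl | rfl | rfl | ⟨he1, he2⟩
  · simp
  · simp
  · simp
  · simp
  · interval_cases e <;> simp

/-- **THE ROWS OF EVERY EXCESS AT `ℓ = 7`:** for `m ∈ {6, 10, 11, 12}` or `14 ≤ m ≤ 21 D` (`2 ≤ D`) there are row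
sizes `1 ≤ k i ≤ 7`, `i < N`, with `Σ k = 7 D` and `Σ k (7 − k) = 2 m`. -/
theorem rows_of_excess_seven (D m : ℕ) (hD : 2 ≤ D)
    (hm : m = 6 ∨ m = 10 ∨ m = 11 ∨ m = 12 ∨ (14 ≤ m ∧ m ≤ 21 * D)) :
    ∃ (N : ℕ) (k : ℕ → ℕ), (∀ i, i < N → 1 ≤ k i ∧ k i ≤ 7) ∧ ∑ i ∈ range N, k i = 7 * D ∧
      ∑ i ∈ range N, k i * (7 - k i) = 2 * m := by
  -- `a` blocks `(1^7)`, the block of `e`, and full rows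
  obtain ⟨a, e, hae, he, haD⟩ : ∃ a e, m = 21 * a + e ∧
      (e = 6 ∨ e = 10 ∨ e = 11 ∨ e = 12 ∨ (14 ≤ e ∧ e ≤ 42)) ∧ a + 2 ≤ D := by
    rcases hm with rfl | rfl | rfl | rfl | ⟨hm1, hm2⟩
    · exact ⟨0, 6, by ring, by omega, by omega⟩
    · exact ⟨0, 10, by ring, by omega, by omega⟩
    · exact ⟨0, 11, by ring, by omega, by omega⟩
    · exact ⟨0, 12, by ring, by omega, by omega⟩
    · refine ⟨min ((m - 14) / 21) (D - 2), m - 21 * min ((m - 14) / 21) (D - 2), by omega, ?_, by omega⟩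
      right; right; right; right
      omega
  obtain ⟨hb1, hb2, hb3, hb5⟩ := blockSeven_facts e he
  set B := blockSeven e with hB
  set c := B.sum / 7 with hc
  have hc' : B.sum = 7 * c := by
    rcases hb2 with h | h <;> rw [h] at hc ⊢ <;> omega
  have hcD : a + c ≤ D := by
    rcases hb2 with h | h <;> rw [h] at hc <;> omega
  set L := List.replicate (7 * a) 1 ++ B ++ List.replicate (D - a - c) 7 with hL
  have hLmem : ∀ x ∈ L, 1 ≤ x ∧ x ≤ 7 := by
    intro x hx
    rw [hL, List.mem_append, List.mem_append, List.mem_replicate, List.mem_replicate] at hx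
    rcases hx with (hx | hx) | hx
    · omega
    · exact hb1 x hx
    · omega
  refine ⟨L.length, fun i => L.getD i 0, fun i hi => getD_bounds_seven L hLmem i hi, ?_, ?_⟩
  · rw [sum_range_getD L (fun x => x), hL, List.map_append, List.map_append, List.sum_append, List.sum_append,
      List.map_id', List.map_id', List.map_id', List.sum_replicate, List.sum_replicate, hc']
    simp only [smul_eq_mul]
    omega
  · rw [sum_range_getD L (fun k => k * (7 - k)), hL, List.map_append, List.map_append, List.sum_append,
      List.sum_append, List.map_replicate, List.map_replicate, List.sum_replicate, List.sum_replicate, hb5]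
    simp only [smul_eq_mul]
    omega

/-- The excess of a row is at most six times its size: `k (7 − k) ≤ 6 k`. -/
theorem excess_le_six_mul (k : ℕ) : k * (7 - k) ≤ 6 * k := by
  rcases Nat.lt_or_ge k 7 with h | h
  · interval_cases k <;> omega
  · rw [Nat.sub_eq_zero_of_le h, mul_zero]
    exact Nat.zero_le _

/-- **THE REGULAR CELL `t = 7 D`, EXACTLY:** for `7 ≤ D`, `t = 7 D`, `2 t ≤ s`, `j` is the band value of a
triangle-free graph on `8 + (s − t)` vertices with `s` edges, a vertex of degree `s − t` and every off-degree `≤ D`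
IFF `j − bottomReg 7 D ∈ {0, 6, 10, 11, 12} ∪ [14, 21 D]`. -/
theorem regular_cell_seven (s t D j : ℕ) (hD : 7 ≤ D) (ht : t = 7 * D) (hs : 2 * t ≤ s) :
    (∃ (H : SimpleGraph (Fin (7 + 1 + (s - t)))) (_ : DecidableRel H.Adj), H.CliqueFree 3 ∧
      H.edgeFinset.card = s ∧ ∃ w, deg H w + t = s ∧ (∀ v, offDeg H w v ≤ D) ∧
        ∑ v, deg H v * deg H v + 2 * (t * (s - t - 1)) + 2 * j = s * (s + 1)) ↔
    (j = bottomReg 7 D ∨ j = bottomReg 7 D + 6 ∨ j = bottomReg 7 D + 10 ∨ j = bottomReg 7 D + 11 ∨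
      j = bottomReg 7 D + 12 ∨ (bottomReg 7 D + 14 ≤ j ∧ j ≤ bottomReg 7 D + 21 * D)) := by
  subst ht
  have hb := two_mul_bottomReg 7 D (by norm_num) hD
  constructor
  · intro hj
    obtain ⟨N, k, hk, hsum, hid⟩ := (regular_cell_iff s (7 * D) 7 D j (by norm_num) hD rfl hs).mp hj
    have hup : ∑ i ∈ range N, k i * (7 - k i) ≤ 42 * D := by
      calc ∑ i ∈ range N, k i * (7 - k i) ≤ ∑ i ∈ range N, 6 * k i := sum_le_sum (fun i _ => excess_le_six_mul (k i))
        _ = 6 * ∑ i ∈ range N, k i := by rw [mul_sum]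
        _ = 42 * D := by rw [hsum]; ring
    have h13 := no_thirteen_seven D k N hk hsum
    rcases row_excess_trichotomy 7 D k N (by norm_num) (fun m hm => (hk m hm).1) (fun m hm => (hk m hm).2) hsum
      with h0 | h1 | h2
    · left
      omega
    · right; left
      omega
    · omega
  · intro hj
    have hval : ∀ m, (m = 6 ∨ m = 10 ∨ m = 11 ∨ m = 12 ∨ (14 ≤ m ∧ m ≤ 21 * D)) →
        (∃ (H : SimpleGraph (Fin (7 + 1 + (s - 7 * D)))) (_ : DecidableRel H.Adj), H.CliqueFree 3 ∧
          H.edgeFinset.card = s ∧ ∃ w, deg H w + 7 * D = s ∧ (∀ v, offDeg H w v ≤ D) ∧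
            ∑ v, deg H v * deg H v + 2 * (7 * D * (s - 7 * D - 1)) + 2 * (bottomReg 7 D + m) = s * (s + 1)) := by
      intro m hm
      apply (regular_cell_iff s (7 * D) 7 D _ (by norm_num) hD rfl hs).mpr
      obtain ⟨N, k, hk, hsum, hex⟩ := rows_of_excess_seven D m (by omega) hm
      refine ⟨N, k, hk, hsum, ?_⟩
      rw [hex]
      omega
    rcases hj with rfl | rfl | rfl | rfl | rfl | ⟨hlo, hhi⟩
    · exact ((regular_cell_first_gap s (7 * D) 7 D (by norm_num) hD rfl hs).2.1)
    · exact hval 6 (by omega)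
    · exact hval 10 (by omega)
    · exact hval 11 (by omega)
    · exact hval 12 (by omega)
    · have := hval (j - bottomReg 7 D) (by omega)
      rwa [Nat.add_sub_cancel' (by omega : bottomReg 7 D ≤ j)] at this

end C047

end TriangleCap

end PercRepro
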